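import Summits.BirchSwinnertonDyer.Rank1Residual.ManinAdditive.TwoEisensteinLegendreRankLawsEdges
import Summits.BirchSwinnertonDyer.BirchSwinnertonDyer.Theorems.ManinLocalTwoThreeTwoEisensteinModTwoDecomposition
import HarnessLib

/-!
# Every level has a 2-Eisenstein rank: DISCHARGE of the `hex` binder of `fourPRankFromTwoP_of_rankLaw`
# (leaf `TwoEisensteinLegendreRankLaws`, imc g16; cell `bsd-f2-manin`, typer g13 — own initiative in the typer lane)

PROVED HERE (nothing asserted): `exists_twoEisensteinRankEq N : ∃ r, TwoEisensteinRankEq N r` for every level `N ≥ 1`,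
i.e. the hypothesis `hex : ∀ N, ∃ r, TwoEisensteinRankEq N r` that imc's kernel edge `fourPRankFromTwoP_of_rankLaw`
(E-94 ∧ Mazur ∧ hex ⟹ E-94♭) and the typer's chains `fourPTwoEisensteinRankOne_of_rankLaw` /
`fourPNoTwoEisenstein_of_rankLaw_three_mod_eight` (`TwoEisensteinLegendreRankLawsEdges`, §C) carried as a binder
(«true since `S₂(ℤ)` is finite free, recorded as a hypothesis»).  Hence the `hex`-FREE edges (primed names):
**E-94 ∧ Mazur ⟹ E-94♭** (`fourPRankFromTwoP_of_rankLaw'`), **E-94 ∧ Mazur ∧ E-81 ⟹ E-85**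
(`fourPTwoEisensteinRankOne_of_rankLaw'`) and **⟹ E-86 for `5 ≤ p ≡ 3 (8)`** (`fourPNoTwoEisenstein_of_rankLaw_three_mod_eight'`)
— BY NAME over the tree rows `FourPTwoPRankLaw`, `MazurNoTwoEisensteinPrimeLevel`, `TwoPNoTwoEisenstein`,
`FourPTwoEisensteinRankOne`, `FourPRankFromTwoPFiveModEight`.

PROOF.  `L = S₂(Γ₀(N); ℤ) = integralCuspForms0 N 2` is a finitely generated `ℤ`-module (lattice basis, Shimura 1971
Thm. 3.52 — tree `…Theorems.ManinLocalTwoThree.moduleFinite_integralCuspForms0` (p-seat file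
`ManinLocalTwoThreeTwoEisensteinModTwoDecomposition`, Mathlib + Literature + leaf imports only, outside the theses cone)
over `Summit.ABC.ABC.Theorems.IGCTorsionSharing.exists_latticeBasis_integralCuspForms0`), so `L/2L` (`2L = range (2•)`,
which is EXACTLY «twice integral») is a finitely generated `2`-torsion `ℤ`-module, hence FINITE
(`Module.finite_of_fg_torsion`), and an `𝔽₂`-vector space (`AddCommGroup.zmodModule`).  The 2-Eisenstein-nilpotent
forms are a SUBGROUP `Nil ≤ L` (zero; sums: `T_ℓ^{n+m}(g+g') = T_ℓ^m(T_ℓ^n g) + T_ℓ^n(T_ℓ^m g')` with `T_ℓ(2L) ⊆ 2L` by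
`heckeT_mem_integralCuspForms0`; negatives), so its image `W ≤ L/2L` is an `𝔽₂`-subspace
(`AddSubgroup.toZModSubmodule`) with a finite basis `B` (`Module.finBasis`), `r := dim_{𝔽₂} W`.  Lift `B` to nilpotent
forms `gs : Fin r → Nil`.  SPANNING (`TwoEisensteinRankLE N r`): for nilpotent `g`, the `B`-coordinates of `ḡ ∈ W` lifted
to `{0,1} ⊂ ℤ` (`ZMod.val`) give `g − Σ cᵢ gsᵢ ∈ 2L`.  INDEPENDENCE (`TwoEisensteinRankGE N r`): if `Σ cᵢ gsᵢ ∈ 2L` then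
`Σ c̄ᵢ Bᵢ = 0` in `W`, so every `c̄ᵢ = 0 ∈ 𝔽₂`, i.e. `2 ∣ cᵢ` (`ZMod.intCast_zmod_eq_zero_iff_dvd`).  The quotient
bookkeeping (`D2 = range (lsmul 2)`, torsion, finiteness) follows the p-seat template of
`integral_decomp_of_twoEisensteinLine` verbatim.  Axioms `[propext, Classical.choice, Quot.sound]`.
bears_on: stmt-BirchSwinnertonDyer-22967 (C2 `ManinOddAtFour`, stub 6d: the imc input E-85 ⟸ E-94 ∧ Mazur ∧ E-81 is now a
two-row reduction with no side binder).  PARTITION 0 · beyond-print theorem: no (linear algebra over the leaf's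
vocabulary) · BSD is not proved by this; Manin's conjecture is not proved by this.
-/

set_option autoImplicit false

noncomputable section

open scoped MatrixGroups
open CongruenceSubgroup
open Literature.NumberTheory.EllipticCurves Literature.NumberTheory.EllipticCurves.ModularForms

namespace Summit.BirchSwinnertonDyer.Rank1Residual.ManinAdditive.TwoEisenstein

/-! ### A. `T_ℓ`-powers on `S₂(ℤ)` and `2·S₂(ℤ)`; the nilpotent forms are a subgroup -/

/-- `T_ℓ^k` (`ℓ ∤ N` prime) preserves `S₂(Γ₀(N); ℤ)`. [folklore] -/
theorem heckeT_pow_mem_integralCuspForms0 (N : ℕ) [NeZero N] (ℓ : ℕ) [NeZero ℓ] (hℓ : ℓ.Prime) (hℓN : ¬ ℓ ∣ N)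
    (k : ℕ) {g : CuspForm (Gamma0 N) 2} (hg : g ∈ integralCuspForms0 N 2) :
    (heckeT (Gamma0 N) 2 ℓ ^ k) g ∈ integralCuspForms0 N 2 := by
  induction k with
  | zero => simpa using hg
  | succ k ih => rw [pow_succ', Module.End.mul_apply]; exact heckeT_mem_integralCuspForms0 ℓ hℓ hℓN ih

/-- `T_ℓ^k` (`ℓ ∤ N` prime) preserves `2·S₂(Γ₀(N); ℤ)`. [folklore] -/
theorem isTwiceIntegral_heckeT_pow (N : ℕ) [NeZero N] (ℓ : ℕ) [NeZero ℓ] (hℓ : ℓ.Prime) (hℓN : ¬ ℓ ∣ N)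
    (k : ℕ) {g : CuspForm (Gamma0 N) 2} (hg : IsTwiceIntegral N g) :
    IsTwiceIntegral N ((heckeT (Gamma0 N) 2 ℓ ^ k) g) := by
  obtain ⟨h, hh, rfl⟩ := hg
  exact ⟨(heckeT (Gamma0 N) 2 ℓ ^ k) h, heckeT_pow_mem_integralCuspForms0 N ℓ hℓ hℓN k hh, by rw [map_smul]⟩

/-- the zero form is 2-Eisenstein-nilpotent. [folklore] -/
theorem isTwoEisensteinNilpotent_zero (N : ℕ) [NeZero N] : IsTwoEisensteinNilpotent N (0 : CuspForm (Gamma0 N) 2) :=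
  ⟨zero_mem _, fun _ _ _ _ => ⟨0, 0, zero_mem _, by rw [pow_zero, Module.End.one_apply, smul_zero]⟩⟩

/-- the 2-Eisenstein-nilpotent forms are closed under addition (`T_ℓ^{n+m}(g + g') = T_ℓ^m(T_ℓ^n g) + T_ℓ^n(T_ℓ^m g')`).
[folklore] -/
theorem isTwoEisensteinNilpotent_add (N : ℕ) [NeZero N] {g g' : CuspForm (Gamma0 N) 2}
    (hg : IsTwoEisensteinNilpotent N g) (hg' : IsTwoEisensteinNilpotent N g') : IsTwoEisensteinNilpotent N (g + g') := by
  refine ⟨add_mem hg.1 hg'.1, fun ℓ hℓ hodd hℓN => ?_⟩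
  haveI : NeZero ℓ := ⟨hℓ.ne_zero⟩
  obtain ⟨n, hn⟩ := hg.2 ℓ hℓ hodd hℓN
  obtain ⟨m, hm⟩ := hg'.2 ℓ hℓ hodd hℓN
  refine ⟨n + m, ?_⟩
  have h1 : (heckeT (Gamma0 N) 2 ℓ ^ (n + m)) g = (heckeT (Gamma0 N) 2 ℓ ^ m) ((heckeT (Gamma0 N) 2 ℓ ^ n) g) := by
    rw [add_comm, pow_add, Module.End.mul_apply]
  have h2 : (heckeT (Gamma0 N) 2 ℓ ^ (n + m)) g' = (heckeT (Gamma0 N) 2 ℓ ^ n) ((heckeT (Gamma0 N) 2 ℓ ^ m) g') := by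
    rw [pow_add, Module.End.mul_apply]
  rw [map_add, h1, h2]
  exact isTwiceIntegral_add N (isTwiceIntegral_heckeT_pow N ℓ hℓ hℓN m hn)
    (isTwiceIntegral_heckeT_pow N ℓ hℓ hℓN n hm)

/-- the 2-Eisenstein-nilpotent forms are closed under negation. [folklore] -/
theorem isTwoEisensteinNilpotent_neg (N : ℕ) [NeZero N] {g : CuspForm (Gamma0 N) 2}
    (hg : IsTwoEisensteinNilpotent N g) : IsTwoEisensteinNilpotent N (-g) := by
  refine ⟨neg_mem hg.1, fun ℓ hℓ hodd hℓN => ?_⟩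
  obtain ⟨n, hn⟩ := hg.2 ℓ hℓ hodd hℓN
  exact ⟨n, by rw [map_neg]; exact isTwiceIntegral_neg N hn⟩

/-- the 2-Eisenstein-nilpotent forms are closed under subtraction. [folklore] -/
theorem isTwoEisensteinNilpotent_sub (N : ℕ) [NeZero N] {g g' : CuspForm (Gamma0 N) 2}
    (hg : IsTwoEisensteinNilpotent N g) (hg' : IsTwoEisensteinNilpotent N g') : IsTwoEisensteinNilpotent N (g - g') := by
  rw [sub_eq_add_neg]; exact isTwoEisensteinNilpotent_add N hg (isTwoEisensteinNilpotent_neg N hg')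

/-! ### B. The rank exists -/

/-- **hex DISCHARGED: every level `N` has a 2-Eisenstein rank** — there is `r` (namely `dim_{𝔽₂}` of the image of the
nilpotent forms in `S₂(Γ₀(N); ℤ)/2`) with `TwoEisensteinRankEq N r`.  Proof: `L = S₂(ℤ)` is finitely generated
(`moduleFinite_integralCuspForms0`), so `L/2L` is finite; give it its `ZMod 2`-module structure, take an `𝔽₂`-basis of
the image `W` of the nilpotent subgroup and lift it to nilpotent forms `gs`; spanning mod `2L` is `TwoEisensteinRankLE`,
independence mod `2L` is `TwoEisensteinRankGE`. [folklore] -/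
theorem exists_twoEisensteinRankEq (N : ℕ) [NeZero N] : ∃ r, TwoEisensteinRankEq N r := by
  classical
  -- the lattice `L = S₂(ℤ)`, its double `2L = D2`, and the finite module `L/2L`
  set L : Submodule ℤ (CuspForm (Gamma0 N) 2) := integralCuspForms0 N 2 with hL
  haveI : Module.Finite ℤ L :=
    Summit.BirchSwinnertonDyer.BirchSwinnertonDyer.Theorems.ManinLocalTwoThree.moduleFinite_integralCuspForms0
  set D2 : Submodule ℤ L := LinearMap.range (LinearMap.lsmul ℤ L 2) with hD2
  have hD2mem : ∀ x : L, x ∈ D2 ↔ ∃ y : L, (2 : ℤ) • y = x := fun x => by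
    simp only [hD2, LinearMap.mem_range, LinearMap.lsmul_apply]
  haveI : Module.Finite ℤ (L ⧸ D2) := Module.Finite.of_surjective D2.mkQ D2.mkQ_surjective
  have htors : Module.IsTorsion ℤ (L ⧸ D2) := by
    intro q
    obtain ⟨x, rfl⟩ := D2.mkQ_surjective q
    refine ⟨⟨2, mem_nonZeroDivisors_of_ne_zero two_ne_zero⟩, ?_⟩
    change (2 : ℤ) • D2.mkQ x = 0
    rw [← map_zsmul, Submodule.mkQ_apply, Submodule.Quotient.mk_eq_zero]
    exact (hD2mem _).mpr ⟨x, rfl⟩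
  haveI : Finite (L ⧸ D2) := Module.finite_of_fg_torsion (L ⧸ D2) htors
  have two_smul_eq : ∀ v : CuspForm (Gamma0 N) 2, (2 : ℂ) • v = (2 : ℤ) • v := fun v => by
    rw [← Int.cast_smul_eq_zsmul ℂ (2 : ℤ) v, Int.cast_ofNat]
  -- `D2` is exactly «twice integral»
  have hD2twice : ∀ x : L, x ∈ D2 ↔ IsTwiceIntegral N (x : CuspForm (Gamma0 N) 2) := by
    intro x
    rw [hD2mem]
    constructor
    · rintro ⟨y, hy⟩
      refine ⟨y, y.2, ?_⟩
      rw [← hy, Submodule.coe_smul_of_tower, two_smul_eq]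
    · rintro ⟨h, hh, hx⟩
      refine ⟨⟨h, hh⟩, Subtype.ext ?_⟩
      rw [Submodule.coe_smul_of_tower, hx, two_smul_eq]
  -- the `𝔽₂`-structure on `L/2L`
  have h2Q : ∀ q : L ⧸ D2, 2 • q = 0 := by
    intro q
    obtain ⟨x, rfl⟩ := D2.mkQ_surjective q
    rw [← map_nsmul, Submodule.mkQ_apply, Submodule.Quotient.mk_eq_zero]
    exact (hD2mem _).mpr ⟨x, by rw [← natCast_zsmul]; rfl⟩
  letI : Module (ZMod 2) (L ⧸ D2) := AddCommGroup.zmodModule h2Q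
  -- the nilpotent subgroup of `L` and its image `W ⊆ L/2L`
  let Nil : AddSubgroup L :=
    { carrier := {x | IsTwoEisensteinNilpotent N (x : CuspForm (Gamma0 N) 2)}
      zero_mem' := by simpa using isTwoEisensteinNilpotent_zero N
      add_mem' := fun {x y} hx hy => by
        simpa only [Set.mem_setOf_eq, Submodule.coe_add] using isTwoEisensteinNilpotent_add N hx hy
      neg_mem' := fun {x} hx => by
        simpa only [Set.mem_setOf_eq, Submodule.coe_neg] using isTwoEisensteinNilpotent_neg N hx }
  have hNil : ∀ x : L, x ∈ Nil ↔ IsTwoEisensteinNilpotent N (x : CuspForm (Gamma0 N) 2) := fun x => Iff.rfl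
  let W : Submodule (ZMod 2) (L ⧸ D2) := AddSubgroup.toZModSubmodule 2 (Nil.map D2.mkQ.toAddMonoidHom)
  have hWmem : ∀ q : L ⧸ D2, q ∈ W ↔ ∃ x : L, IsTwoEisensteinNilpotent N (x : CuspForm (Gamma0 N) 2) ∧ D2.mkQ x = q := by
    intro q
    rw [AddSubgroup.mem_toZModSubmodule, AddSubgroup.mem_map]
    simp only [hNil, LinearMap.toAddMonoidHom_coe]
  -- an `𝔽₂`-basis of `W`, lifted to nilpotent forms
  let r : ℕ := Module.finrank (ZMod 2) W
  let B : Module.Basis (Fin r) (ZMod 2) W := Module.finBasis (ZMod 2) W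
  have hlift : ∀ i, ∃ x : L, IsTwoEisensteinNilpotent N (x : CuspForm (Gamma0 N) 2) ∧ D2.mkQ x = (B i : L ⧸ D2) :=
    fun i => (hWmem _).mp (B i).2
  choose xs hxsnil hxsmk using hlift
  have coe_sum_smul : ∀ c : Fin r → ℤ, ((∑ i, c i • xs i : L) : CuspForm (Gamma0 N) 2) =
      ∑ i, ((c i : ℤ) : ℂ) • (xs i : CuspForm (Gamma0 N) 2) := fun c => by
    rw [Submodule.coe_sum]
    refine Finset.sum_congr rfl fun i _ => ?_
    rw [Submodule.coe_smul_of_tower, Int.cast_smul_eq_zsmul]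
  have mkQ_sum_smul : ∀ c : Fin r → ℤ, D2.mkQ (∑ i, c i • xs i) = ∑ i, ((c i : ℤ) : ZMod 2) • (B i : L ⧸ D2) := fun c => by
    rw [map_sum]
    refine Finset.sum_congr rfl fun i _ => ?_
    rw [map_zsmul, hxsmk, Int.cast_smul_eq_zsmul]
  have coeW_sum_smul : ∀ a : Fin r → ZMod 2, ((∑ i, a i • B i : W) : L ⧸ D2) = ∑ i, a i • (B i : L ⧸ D2) := fun a => by
    rw [Submodule.coe_sum]
    refine Finset.sum_congr rfl fun i _ => ?_
    rw [Submodule.coe_smul]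
  refine ⟨r, ⟨fun i => (xs i : CuspForm (Gamma0 N) 2), fun i => (xs i).2, fun g hg => ?_⟩,
    ⟨fun i => (xs i : CuspForm (Gamma0 N) 2), hxsnil, fun c hc i => ?_⟩⟩
  · -- spanning mod 2: read the coordinates of `ḡ ∈ W` in the basis `B` and lift them to `ℤ`
    let x : L := ⟨g, hg.1⟩
    have hxW : D2.mkQ x ∈ W := (hWmem _).mpr ⟨x, hg, rfl⟩
    let a : Fin r → ZMod 2 := fun i => B.repr ⟨D2.mkQ x, hxW⟩ i
    have hsum : (⟨D2.mkQ x, hxW⟩ : W) = ∑ i, a i • B i := (B.sum_repr _).symm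
    have hsum' : D2.mkQ x = ∑ i, a i • (B i : L ⧸ D2) := by
      rw [← coeW_sum_smul]; exact congrArg Subtype.val hsum
    refine ⟨fun i => ((a i).val : ℤ), ?_⟩
    have hcast : ∀ i, ((((a i).val : ℕ) : ℤ) : ZMod 2) = a i := fun i => by
      rw [Int.cast_natCast, ZMod.natCast_zmod_val]
    have hmem : x - ∑ i, (((a i).val : ℕ) : ℤ) • xs i ∈ D2 := by
      rw [← Submodule.Quotient.mk_eq_zero, ← Submodule.mkQ_apply, map_sub, mkQ_sum_smul, hsum', sub_eq_zero]
      exact Finset.sum_congr rfl fun i _ => by rw [hcast]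
    have htw := (hD2twice _).mp hmem
    rwa [Submodule.coe_sub, coe_sum_smul] at htw
  · -- independence mod 2: a twice-integral combination has zero image in `W`, so even coefficients
    have hmem : (∑ j, c j • xs j : L) ∈ D2 := by
      rw [hD2twice, coe_sum_smul]; exact hc
    have h0 : D2.mkQ (∑ j, c j • xs j) = 0 := by
      rwa [Submodule.mkQ_apply, Submodule.Quotient.mk_eq_zero]
    rw [mkQ_sum_smul] at h0
    have h0' : (∑ j, ((c j : ℤ) : ZMod 2) • B j : W) = 0 := by
      apply Subtype.ext
      rw [coeW_sum_smul, h0, Submodule.coe_zero]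
    have hli := (Fintype.linearIndependent_iff.mp B.linearIndependent) (fun j => ((c j : ℤ) : ZMod 2)) h0' i
    exact (ZMod.intCast_zmod_eq_zero_iff_dvd (c i) 2).mp hli

/-! ### C. The `hex`-free edges (primed names of the §C chains of `TwoEisensteinLegendreRankLawsEdges`) -/

/-- imc's edge WITHOUT the `hex` binder: **E-94 ∧ Mazur ⟹ E-94♭** (`FourPRankFromTwoPFiveModEight`). [folklore] -/
theorem fourPRankFromTwoP_of_rankLaw' (hlaw : FourPTwoPRankLaw) (hMazur : MazurNoTwoEisensteinPrimeLevel) :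
    FourPRankFromTwoPFiveModEight :=
  fourPRankFromTwoP_of_rankLaw hlaw hMazur fun N _ => exists_twoEisensteinRankEq N

/-- **E-94 ∧ Mazur ∧ E-81 ⟹ E-85 BY NAME, `hex`-free.** [folklore] -/
theorem fourPTwoEisensteinRankOne_of_rankLaw' (hlaw : FourPTwoPRankLaw) (hMazur : MazurNoTwoEisensteinPrimeLevel)
    (h81 : TwoPNoTwoEisenstein) : FourPTwoEisensteinRankOne :=
  fourPTwoEisensteinRankOne_of_rankLaw hlaw hMazur (fun N _ => exists_twoEisensteinRankEq N) h81

/-- **E-94 ∧ Mazur ∧ E-81 ⟹ E-86 away from `p = 3`, `hex`-free.** [folklore] -/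
theorem fourPNoTwoEisenstein_of_rankLaw_three_mod_eight' (hlaw : FourPTwoPRankLaw)
    (hMazur : MazurNoTwoEisensteinPrimeLevel) (h81 : TwoPNoTwoEisenstein)
    (p : ℕ) [NeZero (4 * p)] (hp : p.Prime) (h5 : 5 ≤ p) (h3 : p % 8 = 3) :
    ∀ g : CuspForm (Gamma0 (4 * p)) 2, IsTwoEisensteinNilpotent (4 * p) g → IsTwiceIntegral (4 * p) g :=
  fourPNoTwoEisenstein_of_rankLaw_three_mod_eight hlaw hMazur (fun N _ => exists_twoEisensteinRankEq N) h81 p hp h5 h3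

end Summit.BirchSwinnertonDyer.Rank1Residual.ManinAdditive.TwoEisenstein

end
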